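import Summits.CriticalPhenomena.Ising3DConformalLimit.Theses.HyperoctahedralRP
import Summits.CriticalPhenomena.Ising3DConformalLimit.Theorems.HyperoctahedralRPExistsScaleCovariantLimitDoublingOfDyadicPairRatio
import Literature.Probability.LatticeModels.CriticalUrsellFourSign
import HarnessLib

/-!
# Skeleton — crux `ExistsScaleCovariantLimit` (item stmt-CriticalPhenomena-1981), line `Sketch`
(crux idea `two-hierarchies-force-the-filter`, ideator 5; leads prover-line-stmt-CriticalPhenomena-1981-0, -1, continuation leads c1–c6)

## v17 (lead c6, 2026-08-16) — D6 LANDED (p123864, `Theorems/HyperoctahedralRPExistsScaleCovariantLimitDoublingOfDyadicPairRatio.lean`) and IMPORTED: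
sorries = EXACTLY S2', S3'. Importable now (namespace `…TwoHierarchies`): `stub_twoPointDoubling_of_dyadicPairRatio`, `twoPointDoubling_of_dyadicIntConvergence`
(S2' ⟹ 6150), `orbitPrecompact_of_dyadicIntConvergence` (S2' ⟹ 5955), **`crux_iff_dyadicInt_triadicInt` (crux ⟺ S2' ∧ S3')**, `crux_iff_intMeshConvergence`,
`twoPointDoubling_of_pointwiseLimit` (6153 ⟹ 6150), **`crux_iff_pointwiseLimit` (crux ⟺ 6153)**, **`crux_of_zoomMonotone` (14454 ⟹ crux)**,
`monotoneRG_target_of_zoomMonotone`. Wave 1 (S3' worker): `stub-blocked: item 6153` (statuses of 14454/6153/0634/6150 re-checked 20:00Z: all open;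
no unconditional upstream in the tree).

## v16 (lead c6, 2026-08-16) — RESHAPE: S1 IS IMPLIED BY S2'; stubs = { S2', S3', D6 }; a compact rewrite

Observation (new). The registered open stub S2' `stub_dyadicIntConvergence`, specialised to `n = 2` and the single integer pair
`y = (0, 2e₀)`, says that the axis doubling ratio `g(2^{k+1})/g(2^k)` of the critical two-point function `g(m) = ⟨σ₀σ_{m e₀}⟩_{β_c}`
CONVERGES (`pz_two_geomPair`). Its limit is POSITIVE (landed P `stub_geomPairLimit_pos`, p108004: Simon–Lieb chain argument against
`g(m) ≥ c m⁻²`), so `g(2^{k+1}) ≥ (L/2) g(2^k)` eventually, and Messager–Miracle-Solé axis antitonicity interpolates between dyadic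
scales: `κ g(n) ≤ g(2n)` for ALL `n ≥ 1` — ITEM 6150 `TwoPointDoubling` — which by the landed F5 chain (`orbitPrecompact_of_doubling`,
p120504) is ITEM 5955 `OrbitPrecompact` = the former stub S1. New registered glue stub (provable now, written rc0 by this lead as
`Theorems/HyperoctahedralRPExistsScaleCovariantLimitDoublingOfDyadicPairRatio.lean`):
* D6 `stub_twoPointDoubling_of_dyadicPairRatio` : convergence of the pinned pair zoom at `(0, 2e₀)` along `2^{-k}` ⟹ item 6150.
Consequences (sorry-free below modulo the stubs; importable from the D6 module once landed): `orbitPrecompact_of_stubs` (S1 is a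
THEOREM of S2'), **`crux_iff_dyadicInt_triadicInt` (crux ⟺ S2' ∧ S3' — no compactness item: two hierarchies force the filter, compactness
included)**, **`crux_iff_pointwiseLimit` (crux ⟺ ITEM 6153 ALONE; 6153 ⟹ 6150 ⟹ 5955)**, `crux_iff_intMeshConvergence`, and
**`crux_of_zoomMonotone` (ITEM 14454 ALONE ⟹ the crux = route MonotoneRG's target)**. Registered open residue: S2', S3' ONLY — the twin
single-hierarchy integer-configuration convergence problems (DuminilCopinICM2022 §8.4 p. 29 "widely open"; PROMOTION-S2S3.md, lead c4,
stands with "crux ⟺ P1 ⟺ P3 exactly").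

This version is a compact rewrite: every by-product of v1–v15 is a landed, farm-built, importable Theorems module (thirty-three files
`Theorems/HyperoctahedralRPExistsScaleCovariantLimit*.lean`, `Theorems/MonotoneRGZoomGlue*.lean`, `Theorems/ExistsScaleCovariantLimit/Negative/*`),
so the 1 739-line v14 text (version history v5–v14, inline copies of landed glue) is retired to this file's git history (tree commits
≤ 224f60a803bc) and to `Lines/Sketch.md`; the item maps it proved are imported below instead of restated.

## Version history (one line each; details in `Lines/Sketch.md` and the landed modules' docstrings)
v3–v4 (leads 0, -1): crux ⟺ K1 (dyadic loc. unif. convergence) ∧ K2 (triadic identity); 4 glue stubs landed (p86553, p89454, p90948, p90958).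
v5–v6 (c1): K1/K2 split along tightness/uniqueness: S1 = item 5955, S2/S3 uniqueness; S4–S7 landed; MonotoneRG item 14455 closed (p103222).
v7–v8 (c2): uniqueness core at its lattice minimum S2'/S3' (integer configurations along `2^k`/`3^k`); glue B, G, GZ, P, IB, G′ landed.
v9–v13 (c3, c4): crux ⟺ 5955 ∧ 6153 (p116283); 5955 ⟺ 4658 ⟺ PairRegularity ⟸ 0634; under 0634 crux ⟺ S2' ∧ S3' at even `n ≥ 4`.
v14–v15 (c5): F5 p120021; 5955 ⟺ 6150 (p120504); crux ⟺ 6150 ∧ 6153; crux ⟺ 5955 ∧ S2' ∧ S3' (p120217); 6150 ∧ 14454 ⟹ crux (p122713).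
v16 (c6): S2' ⟹ 6150 ⟹ 5955 (D6); crux ⟺ S2' ∧ S3' ⟺ 6153 ⟺ integer-mesh convergence; 14454 ⟹ crux. Stubs { S2', S3', D6 }.
v17 (c6): D6 landed p123864 and imported; stubs { S2', S3' }.

COMPOSITION: `ExistsScaleCovariantLimit_of` — sorry-free given the stubs; concludes
`Summit.CriticalPhenomena.Ising3DConformalLimit.Theses.HyperoctahedralRP.ExistsScaleCovariantLimit` by name.
-/

noncomputable section

namespace Summit.CriticalPhenomena.Ising3DConformalLimit.Cruxes.ExistsScaleCovariantLimit.TwoHierarchies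

open Literature.Probability.LatticeModels Filter Set
open scoped Topology
open Summit.CriticalPhenomena.Ising3DConformalLimit.MoebiusLimitExistsOnlyInteraction (rhoPin)
open Summit.CriticalPhenomena.Ising3DConformalLimit.ExistsScaleCovariantLimitNegative.Dyadic (tendsto_dyad)
open Summit.CriticalPhenomena.Ising3DConformalLimit.Theses

/-! ## Stubs (v17): S2', S3' (OPEN, registered verbatim since v7); D6 is the imported `stub_twoPointDoubling_of_dyadicPairRatio` (p123864) -/

/-- **S2' — dyadic integer-configuration convergence (the core, lattice-intrinsic form).** For every `n` and every
non-coincident configuration `y` with integer coordinates, the pinned zoom along the dyadic meshes,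
`k ↦ ⟨∏ᵢ σ_{2^k yᵢ}⟩_{β_c} · ⟨σ₀σ_{2^k e₀}⟩_{β_c}^{-n/2}`, converges. OPEN (at `n = 2`, `y = (0, 2e₀)` it is convergence of the axis
doubling ratio `g(2^{k+1})/g(2^k)` — which already gives items 6150 and 5955, D6); implied by the crux (`dyadicIntConvergence_of_crux`);
implied by item 14454 alone (`dyadicIntConvergence_of_zoomMonotone`). -/
theorem stub_dyadicIntConvergence :
    ∀ (n : ℕ) (y : Fin n → EuclideanSpace ℝ (Fin 3)), y ∈ NonCoincident 3 n →
      (∀ i j, ∃ z : ℤ, y i j = (z : ℝ)) →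
      ∃ L : ℝ, Tendsto (fun k : ℕ => rescaledCorrelator (criticalCorr 3) rhoPin n (((2:ℝ) ^ k)⁻¹) y)
        atTop (𝓝 L) := by
  sorry

/-- **S3' — triadic integer-configuration convergence (the second prime).** The same along the triadic meshes `3^{-k}`. OPEN;
implied by the crux (`triadicIntConvergence_of_crux`) and by item 14454 alone (`triadicIntConvergence_of_zoomMonotone`). -/
theorem stub_triadicIntConvergence :
    ∀ (n : ℕ) (y : Fin n → EuclideanSpace ℝ (Fin 3)), y ∈ NonCoincident 3 n →
      (∀ i j, ∃ z : ℤ, y i j = (z : ℝ)) →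
      ∃ L : ℝ, Tendsto (fun k : ℕ => rescaledCorrelator (criticalCorr 3) rhoPin n (((3:ℝ) ^ k)⁻¹) y)
        atTop (𝓝 L) := by
  sorry

/-! ## S1 is a theorem of S2' -/

/-- **S2' ⟹ item 6150** (D6 at the instance `n = 2`, `y = (0, 2e₀)` of S2'). -/
theorem twoPointDoubling_of_stubs : MirrorHoelderCompactness.TwoPointDoubling :=
  stub_twoPointDoubling_of_dyadicPairRatio (stub_dyadicIntConvergence 2 _ cfg0_two_mem cfg0_two_intCoord)

/-- **The former stub S1 = item 5955 `OrbitPrecompact` is a THEOREM of S2'** (D6, then the landed F5 chain `orbitPrecompact_of_doubling`,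
p120504). -/
theorem orbitPrecompact_of_stubs : MonotoneRG.OrbitPrecompact :=
  ItemMaps.orbitPrecompact_of_doubling twoPointDoubling_of_stubs

/-! ## Composition -/

/-- **COMPOSITION.** The crux from the stubs S2', S3' (and the glue D6): item 5955 from S2' (`orbitPrecompact_of_stubs`), then the
landed `crux_iff_orbitPrecompact_dyadicInt_triadicInt` (p120217: 5955 ∧ S2' ∧ S3' ⟹ pinned full-filter limit ⟹ crux). -/
theorem ExistsScaleCovariantLimit_of :
    Summit.CriticalPhenomena.Ising3DConformalLimit.Theses.HyperoctahedralRP.ExistsScaleCovariantLimit :=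
  ItemMaps.crux_iff_orbitPrecompact_dyadicInt_triadicInt.2
    ⟨orbitPrecompact_of_stubs, stub_dyadicIntConvergence, stub_triadicIntConvergence⟩

/-! ## By-products — SORRY-FREE (D6 landed): importable verbatim from the D6 module as `crux_iff_dyadicInt_triadicInt`, `crux_iff_pointwiseLimit`, `crux_of_zoomMonotone`; restated here through the imports for the record -/

/-- **crux ⟺ S2' ∧ S3'** — two single-hierarchy integer-configuration convergences ARE the full locally-uniform scale-covariant limit,
compactness included (sorry-free; = imported `crux_iff_dyadicInt_triadicInt`). -/
theorem crux_iff_dyadicInt_triadicInt_skel :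
    HyperoctahedralRP.ExistsScaleCovariantLimit ↔
    ((∀ (n : ℕ) (y : Fin n → EuclideanSpace ℝ (Fin 3)), y ∈ NonCoincident 3 n →
      (∀ i j, ∃ z : ℤ, y i j = (z : ℝ)) →
      ∃ L : ℝ, Tendsto (fun k : ℕ => rescaledCorrelator (criticalCorr 3) rhoPin n (((2:ℝ) ^ k)⁻¹) y)
        atTop (𝓝 L)) ∧
    (∀ (n : ℕ) (y : Fin n → EuclideanSpace ℝ (Fin 3)), y ∈ NonCoincident 3 n →
      (∀ i j, ∃ z : ℤ, y i j = (z : ℝ)) →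
      ∃ L : ℝ, Tendsto (fun k : ℕ => rescaledCorrelator (criticalCorr 3) rhoPin n (((3:ℝ) ^ k)⁻¹) y)
        atTop (𝓝 L))) := by
  rw [ItemMaps.crux_iff_orbitPrecompact_dyadicInt_triadicInt]
  exact ⟨fun h => h.2, fun h => ⟨ItemMaps.orbitPrecompact_of_doubling
    (stub_twoPointDoubling_of_dyadicPairRatio (h.1 2 _ cfg0_two_mem cfg0_two_intCoord)), h⟩⟩

/-- **crux ⟺ ITEM 6153 `PointwiseLimit` ALONE** (sorry-free; = imported `crux_iff_pointwiseLimit`): full-filter pointwise convergence at the one pair `(0, 2e₀)` already gives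
item 6150, hence item 5955, and crux ⟺ 5955 ∧ 6153 is landed (p116283). -/
theorem crux_iff_pointwiseLimit_skel :
    HyperoctahedralRP.ExistsScaleCovariantLimit ↔ MirrorHoelderCompactness.PointwiseLimit := by
  rw [stub_cruxIffOrbitPrecompactPointwiseLimit]
  refine ⟨fun h => h.2, fun hPL => ⟨?_, hPL⟩⟩
  obtain ⟨l, hl⟩ := hPL 2 _ cfg0_two_mem
  rw [rhoStar_eq_rhoPin] at hl
  exact ItemMaps.orbitPrecompact_of_doubling (stub_twoPointDoubling_of_dyadicPairRatio ⟨l, hl.comp tendsto_dyad⟩)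

/-- Orders `0` and odd are FREE along every mesh sequence: the pinned zoom is the constant `1` at order `0` and the constant `0` at odd
orders (odd critical correlators vanish on `ℤ³`, `m*(β_c) = 0`, `criticalCorr_eq_zero_of_odd`). [folklore] -/
theorem zeroOdd_orders_tendsto (u : ℕ → ℝ) {n : ℕ} (hn : n = 0 ∨ Odd n) (y : Fin n → EuclideanSpace ℝ (Fin 3)) :
    ∃ L : ℝ, Tendsto (fun k : ℕ => rescaledCorrelator (criticalCorr 3) rhoPin n (u k) y) atTop (𝓝 L) := by
  rcases hn with rfl | hodd
  · refine ⟨rescaledCorrelator (criticalCorr 3) rhoPin 0 (u 0) y, tendsto_const_nhds.congr fun k => ?_⟩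
    rw [rescaledCorrelator_apply, rescaledCorrelator_apply, pow_zero, pow_zero]
    congr 2
    funext i
    exact Fin.elim0 i
  · refine ⟨0, tendsto_const_nhds.congr fun k => ?_⟩
    rw [rescaledCorrelator_apply, criticalCorr_eq_zero_of_odd le_rfl hodd, mul_zero]

/-- From the even orders `n ≥ 2` to all orders (orders `0` and odd are free, `zeroOdd_orders_tendsto`). [folklore] -/
theorem allOrders_of_evenGeTwo (u : ℕ → ℝ)
    (h : ∀ (n : ℕ), Even n → 2 ≤ n → ∀ (y : Fin n → EuclideanSpace ℝ (Fin 3)), y ∈ NonCoincident 3 n →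
      (∀ i j, ∃ z : ℤ, y i j = (z : ℝ)) →
      ∃ L : ℝ, Tendsto (fun k : ℕ => rescaledCorrelator (criticalCorr 3) rhoPin n (u k) y) atTop (𝓝 L)) :
    ∀ (n : ℕ) (y : Fin n → EuclideanSpace ℝ (Fin 3)), y ∈ NonCoincident 3 n →
      (∀ i j, ∃ z : ℤ, y i j = (z : ℝ)) →
      ∃ L : ℝ, Tendsto (fun k : ℕ => rescaledCorrelator (criticalCorr 3) rhoPin n (u k) y) atTop (𝓝 L) := by
  intro n y hy hint
  rcases Nat.even_or_odd n with heven | hodd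
  · rcases Nat.eq_zero_or_pos n with h0 | hpos
    · exact zeroOdd_orders_tendsto u (Or.inl h0) y
    · have h2 : 2 ≤ n := by
        obtain ⟨m, rfl⟩ := heven
        omega
      exact h n heven h2 y hy hint
  · exact zeroOdd_orders_tendsto u (Or.inr hodd) y

/-- **crux ⟺ S2' ∧ S3' AT EVEN ORDERS `n ≥ 2` ONLY** (sorry-free): the honest open residue of the 3D-Ising existence problem on this line
is the convergence, for every EVEN `n ≥ 2` and every non-coincident integer configuration `y ∈ (ℤ³)ⁿ`, of the two explicit sequences
`⟨∏ᵢσ_{2^k yᵢ}⟩_{β_c}/⟨σ₀σ_{2^k e₀}⟩_{β_c}^{n/2}` and `⟨∏ᵢσ_{3^k yᵢ}⟩_{β_c}/⟨σ₀σ_{3^k e₀}⟩_{β_c}^{n/2}` (at `n = 2`: the "dyadic/triadic `η`"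
ratios `G(2^k v)/g(2^k)`, `G(3^k v)/g(3^k)`, `v ∈ ℤ³ ∖ {0}`; under item 0634 only EVEN `n ≥ 4` remain, `ItemMaps.crux_iff_evenGeFour_of_twoPointLaw`). -/
theorem crux_iff_evenGeTwo_dyadicInt_triadicInt :
    HyperoctahedralRP.ExistsScaleCovariantLimit ↔
    ((∀ (n : ℕ), Even n → 2 ≤ n → ∀ (y : Fin n → EuclideanSpace ℝ (Fin 3)), y ∈ NonCoincident 3 n →
      (∀ i j, ∃ z : ℤ, y i j = (z : ℝ)) →
      ∃ L : ℝ, Tendsto (fun k : ℕ => rescaledCorrelator (criticalCorr 3) rhoPin n (((2:ℝ) ^ k)⁻¹) y)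
        atTop (𝓝 L)) ∧
    (∀ (n : ℕ), Even n → 2 ≤ n → ∀ (y : Fin n → EuclideanSpace ℝ (Fin 3)), y ∈ NonCoincident 3 n →
      (∀ i j, ∃ z : ℤ, y i j = (z : ℝ)) →
      ∃ L : ℝ, Tendsto (fun k : ℕ => rescaledCorrelator (criticalCorr 3) rhoPin n (((3:ℝ) ^ k)⁻¹) y)
        atTop (𝓝 L))) := by
  rw [crux_iff_dyadicInt_triadicInt]
  constructor
  · rintro ⟨h2, h3⟩
    exact ⟨fun n _ _ y hy hint => h2 n y hy hint, fun n _ _ y hy hint => h3 n y hy hint⟩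
  · rintro ⟨h2, h3⟩
    exact ⟨allOrders_of_evenGeTwo (fun k : ℕ => ((2:ℝ) ^ k)⁻¹) h2, allOrders_of_evenGeTwo (fun k : ℕ => ((3:ℝ) ^ k)⁻¹) h3⟩

/- **ITEM 14454 `ZoomMonotone` ALONE ⟹ THE CRUX** is the imported, sorry-free `crux_of_zoomMonotone : MonotoneRG.ZoomMonotone →
HyperoctahedralRP.ExistsScaleCovariantLimit` (p123864); it is not restated here so that the skeleton's only theorem concluding the crux
decl is the composition `ExistsScaleCovariantLimit_of` (closed modulo S2', S3'). -/

end Summit.CriticalPhenomena.Ising3DConformalLimit.Cruxes.ExistsScaleCovariantLimit.TwoHierarchies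

end
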